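import Summits.QuantumFields.YangMills.Theorems.HyperbolicRegulatorCurvatureUniformityRStubSumMatchAux

/-!
# Route `HyperbolicRegulator`, crux `CurvatureUniformityR` (stmt-QuantumFields-18154), line `single-chart-markov`:
# helpers for the stub `stub_sumMatch` (II) — chart squares

Helper file (lead `prover-line-stmt-QuantumFields-18154-0`) for the registered stub
`stub_sumMatch : ChartInteriorStructure → PlaquetteSumMatch` of the skeleton `Cruxes/CurvatureUniformityR/Lines/Sketch.lean`.
Elementary combinatorics of the flat chart of a repaired-admissible complex (`AdmR`, axiom 9, and the landed (E0)/(E2) of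
`StubChartInterior`); nothing asserted about the route. The edge-id set of the chart square at a grid point `a` is
`{(cE x a 0).1, (cE x (nx2 a 0) 1).1, (cE x (nx2 a 1) 0).1, (cE x a 1).1}` (the shape of axiom 9's square clause); a
*square choice* is a function `sq : ℤ × ℤ → ℕ` picking, at every grid point whose unit square lies in the box, a square
of `Q` with that id set (`exists_sq`, axiom 9).

* `card_sqIds`, `sqIds_inj` — the id set has four elements and determines the grid point (E0);
* `eq_sq_or_of_edge_zero/one` — a square through an interior chart edge is one of the two flanking chosen squares ((E2)
  keeping the squares);
* `retr_bd_of_image_eq` — the boundary holonomy of a square carrying the chart square's ids has the `Re tr ρ` of the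
  chart plaquette holonomy, for any flag-respecting reading `φ` of flagged edges (square word normal form of file (I)).
-/

set_option autoImplicit false

namespace Summit.QuantumFields.YangMills.Cruxes.CurvatureUniformityR.SingleChartMarkov

open Finset Summit.QuantumFields.YangMills.Theorems.HyperbolicToTorus.Negative
open Literature.MathematicalPhysics.QuantumFieldTheory (LatticeRep)

namespace StubSumMatch

open StubChartInterior

section ChartSquares

variable {k j : ℕ} {V E Q : Finset ℕ} {σ τ : ℕ → ℕ} {bd : ℕ → Fin 4 → ℕ × Bool} {cV : ℕ → ℤ × ℤ → ℕ}
  {cE : ℕ → ℤ × ℤ → Fin 2 → ℕ × Bool} {x : ℕ}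

/-- **A square choice exists** (axiom 9): at every grid point whose unit square lies in the box one can pick a square
of `Q` carrying the chart square's edge ids. -/
theorem exists_sq (hA : AdmR k j V E Q σ τ bd cV cE) (hx : IsFlatR k V E σ τ x) :
    ∃ sq : ℤ × ℤ → ℕ, ∀ a : ℤ × ℤ, inBox2 k a → inBox2 k (a.1 + 1, a.2 + 1) → sq a ∈ Q ∧
      Finset.univ.image (Prod.fst ∘ bd (sq a)) =
        {(cE x a 0).1, (cE x (nx2 a 0) 1).1, (cE x (nx2 a 1) 0).1, (cE x a 1).1} := by
  have h := (hA.chart hx).2.2.2.2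
  choose! sq hQ himg using h
  exact ⟨sq, fun a ha hc => ⟨hQ a ha hc, himg a ha hc⟩⟩

/-- The four edge ids of a chart square in the box are pairwise distinct (E0), so the id set has four elements. -/
theorem card_sqIds (hA : AdmR k j V E Q σ τ bd cV cE) (hx : IsFlatR k V E σ τ x) (a : ℤ × ℤ)
    (ha : inBox2 k a) (hc : inBox2 k (a.1 + 1, a.2 + 1)) :
    ({(cE x a 0).1, (cE x (nx2 a 0) 1).1, (cE x (nx2 a 1) 0).1, (cE x a 1).1} : Finset ℕ).card = 4 := by
  have bR : inBox2 k (nx2 a 0) := by simp only [inBox2, nx2_zero, abs_le] at *; omega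
  have bU : inBox2 k (nx2 a 1) := by simp only [inBox2, nx2_one, abs_le] at *; omega
  have bRU : inBox2 k (nx2 (nx2 a 0) 1) := by simp only [inBox2, nx2_zero, nx2_one, abs_le] at *; omega
  have bUR : inBox2 k (nx2 (nx2 a 1) 0) := by simp only [inBox2, nx2_zero, nx2_one, abs_le] at *; omega
  have d01 := cE_ne hA hx ha bR bR bRU (Or.inl (by simp [nx2_zero]))
  have d02 := cE_ne hA hx ha bR bU bUR (Or.inr (Or.inl (by simp [nx2_one])))
  have d03 := cE_ne hA hx ha bR ha bU (Or.inr (Or.inr (by decide)))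
  have d12 := cE_ne hA hx bR bRU bU bUR (Or.inl (by simp [nx2_zero, nx2_one]))
  have d13 := cE_ne hA hx bR bRU ha bU (Or.inl (by simp [nx2_zero]))
  have d23 := cE_ne hA hx bU bUR ha bU (Or.inr (Or.inl (by simp [nx2_one])))
  rw [card_insert_of_notMem (by simp [d01, d02, d03]), card_insert_of_notMem (by simp [d12, d13]),
    card_insert_of_notMem (by simp [d23]), card_singleton]

/-- Chart squares at different grid points of the box have different edge-id sets (E0). -/
theorem sqIds_inj (hA : AdmR k j V E Q σ τ bd cV cE) (hx : IsFlatR k V E σ τ x) {a a' : ℤ × ℤ}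
    (ha : inBox2 k a) (hc : inBox2 k (a.1 + 1, a.2 + 1)) (ha' : inBox2 k a') (hc' : inBox2 k (a'.1 + 1, a'.2 + 1))
    (h : ({(cE x a 0).1, (cE x (nx2 a 0) 1).1, (cE x (nx2 a 1) 0).1, (cE x a 1).1} : Finset ℕ) =
      {(cE x a' 0).1, (cE x (nx2 a' 0) 1).1, (cE x (nx2 a' 1) 0).1, (cE x a' 1).1}) : a = a' := by
  have bR : inBox2 k (nx2 a 0) := by simp only [inBox2, nx2_zero, abs_le] at *; omega
  have bU : inBox2 k (nx2 a 1) := by simp only [inBox2, nx2_one, abs_le] at *; omega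
  have bR' : inBox2 k (nx2 a' 0) := by simp only [inBox2, nx2_zero, abs_le] at *; omega
  have bU' : inBox2 k (nx2 a' 1) := by simp only [inBox2, nx2_one, abs_le] at *; omega
  have bRU' : inBox2 k (nx2 (nx2 a' 0) 1) := by simp only [inBox2, nx2_zero, nx2_one, abs_le] at *; omega
  have bUR' : inBox2 k (nx2 (nx2 a' 1) 0) := by simp only [inBox2, nx2_zero, nx2_one, abs_le] at *; omega
  have h0 : (cE x a 0).1 ∈ ({(cE x a' 0).1, (cE x (nx2 a' 0) 1).1, (cE x (nx2 a' 1) 0).1, (cE x a' 1).1} : Finset ℕ) :=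
    h ▸ (by simp)
  have h1 : (cE x a 1).1 ∈ ({(cE x a' 0).1, (cE x (nx2 a' 0) 1).1, (cE x (nx2 a' 1) 0).1, (cE x a' 1).1} : Finset ℕ) :=
    h ▸ (by simp)
  simp only [mem_insert, mem_singleton] at h0 h1
  rcases h0 with h0 | h0 | h0 | h0
  · exact (cE_inj hA hx ha bR ha' bR' h0).1
  · exact absurd (cE_inj hA hx ha bR bR' bRU' h0).2 (by decide)
  · have e0 := (cE_inj hA hx ha bR bU' bUR' h0).1
    rcases h1 with h1 | h1 | h1 | h1
    · exact absurd (cE_inj hA hx ha bU ha' bR' h1).2 (by decide)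
    · have e1 := (cE_inj hA hx ha bU bR' bRU' h1).1
      rw [e1, nx2_zero, nx2_one, Prod.mk.injEq] at e0
      omega
    · exact absurd (cE_inj hA hx ha bU bU' bUR' h1).2 (by decide)
    · exact (cE_inj hA hx ha bU ha' bU' h1).1
  · exact absurd (cE_inj hA hx ha bR ha' bU' h0).2 (by decide)

variable {sq : ℤ × ℤ → ℕ}

/-- **(E2) with chosen squares, horizontal edge.** For a square choice `sq`, a square of `Q` through the interior chart
edge `cE x a 0` is the chosen square at `a` or the chosen square at `(a.1, a.2 - 1)` (the proof of
`StubChartInterior.sq_through_edge_zero`, keeping the squares: both are squares through the edge, they differ by (E0), and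
an edge lies in exactly two squares, axiom 3). -/
theorem eq_sq_or_of_edge_zero (hA : AdmR k j V E Q σ τ bd cV cE) (hx : IsFlatR k V E σ τ x)
    (hsq : ∀ a : ℤ × ℤ, inBox2 k a → inBox2 k (a.1 + 1, a.2 + 1) → sq a ∈ Q ∧
      Finset.univ.image (Prod.fst ∘ bd (sq a)) = {(cE x a 0).1, (cE x (nx2 a 0) 1).1, (cE x (nx2 a 1) 0).1, (cE x a 1).1})
    (a : ℤ × ℤ) (ha : inBox2 k a) (hb : inBox2 k (a.1 + 1, a.2)) (hc : inBox2 k (a.1 + 1, a.2 + 1))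
    (hd : inBox2 k (a.1, a.2 - 1)) {q : ℕ} (hq : q ∈ Q) (hqe : ∃ i, (bd q i).1 = (cE x a 0).1) :
    q = sq a ∨ q = sq (a.1, a.2 - 1) := by
  -- box bookkeeping
  have bR : inBox2 k (nx2 a 0) := hb
  have bU : inBox2 k (nx2 a 1) := by simp only [inBox2, nx2_one, abs_le] at *; omega
  have eD : nx2 (a.1, a.2 - 1) 1 = a := by simp only [nx2_one, sub_add_cancel, Prod.mk.eta]
  have bDU : inBox2 k (nx2 (a.1, a.2 - 1) 1) := by rw [eD]; exact ha
  have bDR : inBox2 k (nx2 (a.1, a.2 - 1) 0) := by simp only [inBox2, nx2_zero, abs_le] at *; omega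
  have bDR' : inBox2 k (a.1 + 1, a.2 - 1) := by simp only [inBox2, abs_le] at *; omega
  have bDRU : inBox2 k (nx2 (a.1 + 1, a.2 - 1) 1) := by simp only [inBox2, nx2_one, abs_le] at *; omega
  have bD1 : inBox2 k ((a.1, a.2 - 1).1 + 1, (a.1, a.2 - 1).2 + 1) := by
    simp only [inBox2, abs_le] at *; omega
  -- the edge and its two flanking chosen squares
  obtain ⟨heE, -⟩ := chart_edge_pair hA hx a 0 ha bR
  obtain ⟨hqaQ, hqa⟩ := hsq a ha hc
  obtain ⟨hqbQ, hqb⟩ := hsq (a.1, a.2 - 1) hd bD1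
  rw [eD] at hqb
  have hea : ∃ i, (bd (sq a) i).1 = (cE x a 0).1 := mem_image_fst_bd.1 (by rw [hqa]; simp)
  have heb : ∃ i, (bd (sq (a.1, a.2 - 1)) i).1 = (cE x a 0).1 := mem_image_fst_bd.1 (by rw [hqb]; simp)
  have hab : sq a ≠ sq (a.1, a.2 - 1) := by
    intro h
    have hm : (cE x a 1).1 ∈ Finset.univ.image (Prod.fst ∘ bd (sq (a.1, a.2 - 1))) := by rw [← h, hqa]; simp
    rw [hqb] at hm
    simp only [nx2_zero, mem_insert, mem_singleton] at hm
    rcases hm with hm | hm | hm | hm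
    · exact cE_ne hA hx ha bU hd bDR (Or.inr (Or.inr (by decide))) hm
    · exact cE_ne hA hx ha bU bDR' bDRU (Or.inl (by simp)) hm
    · exact cE_ne hA hx ha bU ha bR (Or.inr (Or.inr (by decide))) hm
    · exact cE_ne hA hx ha bU hd bDU (Or.inr (Or.inl (by simp; omega))) hm
  exact eq_or_eq_of_two_squares hA.2.2.1 heE hqaQ hqbQ hq hea heb hqe hab

/-- **(E2) with chosen squares, vertical edge.** For a square choice `sq`, a square of `Q` through the interior chart
edge `cE x a 1` is the chosen square at `a` or the chosen square at `(a.1 - 1, a.2)`. -/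
theorem eq_sq_or_of_edge_one (hA : AdmR k j V E Q σ τ bd cV cE) (hx : IsFlatR k V E σ τ x)
    (hsq : ∀ a : ℤ × ℤ, inBox2 k a → inBox2 k (a.1 + 1, a.2 + 1) → sq a ∈ Q ∧
      Finset.univ.image (Prod.fst ∘ bd (sq a)) = {(cE x a 0).1, (cE x (nx2 a 0) 1).1, (cE x (nx2 a 1) 0).1, (cE x a 1).1})
    (a : ℤ × ℤ) (ha : inBox2 k a) (hb : inBox2 k (a.1, a.2 + 1)) (hc : inBox2 k (a.1 + 1, a.2 + 1))
    (hd : inBox2 k (a.1 - 1, a.2)) {q : ℕ} (hq : q ∈ Q) (hqe : ∃ i, (bd q i).1 = (cE x a 1).1) :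
    q = sq a ∨ q = sq (a.1 - 1, a.2) := by
  -- box bookkeeping
  have bU : inBox2 k (nx2 a 1) := hb
  have bR : inBox2 k (nx2 a 0) := by simp only [inBox2, nx2_zero, abs_le] at *; omega
  have eL : nx2 (a.1 - 1, a.2) 0 = a := by simp only [nx2_zero, sub_add_cancel, Prod.mk.eta]
  have bLR : inBox2 k (nx2 (a.1 - 1, a.2) 0) := by rw [eL]; exact ha
  have bLU : inBox2 k (nx2 (a.1 - 1, a.2) 1) := by simp only [inBox2, nx2_one, abs_le] at *; omega
  have bLU' : inBox2 k (a.1 - 1, a.2 + 1) := by simp only [inBox2, abs_le] at *; omega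
  have bLUR : inBox2 k (nx2 (a.1 - 1, a.2 + 1) 0) := by simp only [inBox2, nx2_zero, abs_le] at *; omega
  have bL1 : inBox2 k ((a.1 - 1, a.2).1 + 1, (a.1 - 1, a.2).2 + 1) := by
    simp only [inBox2, abs_le] at *; omega
  -- the edge and its two flanking chosen squares
  obtain ⟨heE, -⟩ := chart_edge_pair hA hx a 1 ha bU
  obtain ⟨hqaQ, hqa⟩ := hsq a ha hc
  obtain ⟨hqbQ, hqb⟩ := hsq (a.1 - 1, a.2) hd bL1
  rw [eL] at hqb
  have hea : ∃ i, (bd (sq a) i).1 = (cE x a 1).1 := mem_image_fst_bd.1 (by rw [hqa]; simp)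
  have heb : ∃ i, (bd (sq (a.1 - 1, a.2)) i).1 = (cE x a 1).1 := mem_image_fst_bd.1 (by rw [hqb]; simp)
  have hab : sq a ≠ sq (a.1 - 1, a.2) := by
    intro h
    have hm : (cE x a 0).1 ∈ Finset.univ.image (Prod.fst ∘ bd (sq (a.1 - 1, a.2))) := by rw [← h, hqa]; simp
    rw [hqb] at hm
    simp only [nx2_one, mem_insert, mem_singleton] at hm
    rcases hm with hm | hm | hm | hm
    · exact cE_ne hA hx ha bR hd bLR (Or.inl (by simp; omega)) hm
    · exact cE_ne hA hx ha bR ha bU (Or.inr (Or.inr (by decide))) hm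
    · exact cE_ne hA hx ha bR bLU' bLUR (Or.inl (by simp; omega)) hm
    · exact cE_ne hA hx ha bR hd bLU (Or.inr (Or.inr (by decide))) hm
  exact eq_or_eq_of_two_squares hA.2.2.1 heE hqaQ hqbQ hq hea heb hqe hab

/-- **The weight of a chart square.** For a square `q` of `Q` carrying the edge ids of the chart square at `a` and
any flag-respecting reading `φ` of flagged edges (`φ (e.1, !e.2) = (φ e)⁻¹`), `Re tr ρ` of the boundary holonomy of
`q` equals `Re tr ρ` of the chart plaquette holonomy `φ(→a) φ(↑(a+e₁)) φ(→(a+e₂))⁻¹ φ(↑a)⁻¹`: by axiom 2 the boundary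
word is closed and consecutive with pairwise distinct ids (four ids, four slots), the chart edges form a 4-cycle on
pairwise distinct corners (chart injectivity), so the square word normal form of file (I) applies. -/
theorem retr_bd_of_image_eq {G : Type} [Group G] [TopologicalSpace G] (r : LatticeRep G)
    (hA : AdmR k j V E Q σ τ bd cV cE) (hx : IsFlatR k V E σ τ x) (a : ℤ × ℤ)
    (ha : inBox2 k a) (hc : inBox2 k (a.1 + 1, a.2 + 1)) {q : ℕ} (hq : q ∈ Q)
    (himg : Finset.univ.image (Prod.fst ∘ bd q) =
      {(cE x a 0).1, (cE x (nx2 a 0) 1).1, (cE x (nx2 a 1) 0).1, (cE x a 1).1})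
    (φ : ℕ × Bool → G) (hφ : ∀ e : ℕ × Bool, φ (e.1, !e.2) = (φ e)⁻¹) :
    (r.ρ (φ (bd q 0) * φ (bd q 1) * φ (bd q 2) * φ (bd q 3))).trace.re =
      (r.ρ (φ (cE x a 0) * φ (cE x (nx2 a 0) 1) * (φ (cE x (nx2 a 1) 0))⁻¹ * (φ (cE x a 1))⁻¹)).trace.re := by
  have bR : inBox2 k (nx2 a 0) := by simp only [inBox2, nx2_zero, abs_le] at *; omega
  have bU : inBox2 k (nx2 a 1) := by simp only [inBox2, nx2_one, abs_le] at *; omega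
  have bRU : inBox2 k (nx2 (nx2 a 0) 1) := by simp only [inBox2, nx2_zero, nx2_one, abs_le] at *; omega
  have bUR : inBox2 k (nx2 (nx2 a 1) 0) := by simp only [inBox2, nx2_zero, nx2_one, abs_le] at *; omega
  have hinj := (hA.chart hx).2.2.1
  have e0 := hA.chart_edge hx a 0 ha bR
  have e1 := hA.chart_edge hx (nx2 a 0) 1 bR bRU
  have e2 := hA.chart_edge hx (nx2 a 1) 0 bU bUR
  have e3 := hA.chart_edge hx a 1 ha bU
  -- the reference cycle and its corners
  set c : Fin 4 → ℕ × Bool :=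
    ![cE x a 0, cE x (nx2 a 0) 1, ((cE x (nx2 a 1) 0).1, !(cE x (nx2 a 1) 0).2), ((cE x a 1).1, !(cE x a 1).2)]
    with hc_def
  set v : Fin 4 → ℕ := ![cV x a, cV x (nx2 a 0), cV x (nx2 (nx2 a 0) 1), cV x (nx2 a 1)] with hv_def
  have hRU : nx2 (nx2 a 1) 0 = nx2 (nx2 a 0) 1 := by simp only [nx2_zero, nx2_one]
  have hv : Function.Injective v := by
    have hne : ∀ {p p' : ℤ × ℤ}, inBox2 k p → inBox2 k p' → p ≠ p' → cV x p ≠ cV x p' :=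
      fun hp hp' hne h => hne (hinj hp hp' h)
    have n01 := hne ha bR (by simp [nx2_zero, Prod.ext_iff])
    have n02 := hne ha bRU (by simp [nx2_zero, nx2_one, Prod.ext_iff])
    have n03 := hne ha bU (by simp [nx2_one, Prod.ext_iff])
    have n12 := hne bR bRU (by simp [nx2_zero, nx2_one, Prod.ext_iff])
    have n13 := hne bR bU (by simp [nx2_zero, nx2_one, Prod.ext_iff])
    have n23 := hne bRU bU (by simp [nx2_zero, nx2_one, Prod.ext_iff])
    intro i i' h
    fin_cases i <;> fin_cases i' <;> simp only [hv_def, Fin.zero_eta, Fin.mk_one, Fin.reduceFinMk, Fin.isValue,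
      Matrix.cons_val_zero, Matrix.cons_val_one, Matrix.cons_val] at h ⊢
    all_goals first
      | exact absurd h n01 | exact absurd h.symm n01 | exact absurd h n02 | exact absurd h.symm n02
      | exact absurd h n03 | exact absurd h.symm n03 | exact absurd h n12 | exact absurd h.symm n12
      | exact absurd h n13 | exact absurd h.symm n13 | exact absurd h n23 | exact absurd h.symm n23
  have hcs : ∀ i, (if (c i).2 then σ (c i).1 else τ (c i).1) = v i := by
    intro i
    fin_cases i <;> simp only [hc_def, hv_def, Fin.zero_eta, Fin.mk_one, Fin.reduceFinMk, Fin.isValue,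
      Matrix.cons_val_zero, Matrix.cons_val_one, Matrix.cons_val]
    · exact e0.2.1
    · exact e1.2.1
    · exact (st_rev σ τ _).trans (e2.2.2.trans (congrArg (cV x) hRU))
    · exact (st_rev σ τ _).trans e3.2.2
  have hce : ∀ i, (if (c i).2 then τ (c i).1 else σ (c i).1) = v (i + 1) := by
    intro i
    fin_cases i <;> simp only [hc_def, hv_def, Fin.zero_eta, Fin.mk_one, Fin.reduceFinMk, Fin.isValue,
      Matrix.cons_val_zero, Matrix.cons_val_one, Matrix.cons_val, Fin.reduceAdd]
    · exact e0.2.2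
    · exact e1.2.2
    · exact (en_rev σ τ _).trans e2.2.1
    · exact (en_rev σ τ _).trans e3.2.1
  have hw : ∀ i, (if (bd q i).2 then τ (bd q i).1 else σ (bd q i).1) =
      (if (bd q (i + 1)).2 then σ (bd q (i + 1)).1 else τ (bd q (i + 1)).1) := fun i => (hA.squares q hq).2.1 i
  have hwi : Function.Injective (Prod.fst ∘ bd q) := by
    have h4 : (Finset.univ.image (Prod.fst ∘ bd q)).card = (Finset.univ : Finset (Fin 4)).card := by
      rw [himg, card_sqIds hA hx a ha hc, card_univ, Fintype.card_fin]
    have := Finset.card_image_iff.1 h4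
    rwa [coe_univ, Set.injOn_univ] at this
  have hids : ∀ i, ∃ m, (bd q i).1 = (c m).1 := by
    intro i
    have hm : (bd q i).1 ∈ ({(cE x a 0).1, (cE x (nx2 a 0) 1).1, (cE x (nx2 a 1) 0).1, (cE x a 1).1} : Finset ℕ) :=
      himg ▸ mem_image_of_mem (Prod.fst ∘ bd q) (mem_univ i)
    simp only [mem_insert, mem_singleton] at hm
    rcases hm with hm | hm | hm | hm
    · exact ⟨0, by simpa [hc_def] using hm⟩
    · exact ⟨1, by simpa [hc_def] using hm⟩
    · exact ⟨2, by simpa [hc_def] using hm⟩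
    · exact ⟨3, by simpa [hc_def] using hm⟩
  have key := square_word_normal_form hv hcs hce hw hwi hids
  rw [retr_word_eq r φ hφ key]
  simp [hc_def, hφ]

end ChartSquares

end StubSumMatch

end Summit.QuantumFields.YangMills.Cruxes.CurvatureUniformityR.SingleChartMarkov
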